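/-
Copyright (c) 2026 the pub-hodgecm-mathlib formalisation cell (harness21).  Prover seat hodgecm-mathlib-K2Liu-p09 (g6): Track B «K2-LIT»,
hLiu418 = stmt-HodgeConjecture-24832; LEAD F0P6-plan RULINGS M-156m∕M-157q (A7-val paper-first), file V1 of the A7-val census (road-neutral).
-/
import Summits.HodgeConjecture.HodgeConjecture.Theorems.K2LiuFlatSiegelFamilies            -- ★ B2 `exists_absDetDelta_eq_zpow`, `isQRationalRegularAt_zpow_cpow_add`; ★ F1, ★ T1
import Summits.HodgeConjecture.HodgeConjecture.Theorems.K2LiuLocalIntertwiningProperty      -- ★ `absDetDelta_pos` ∕ `_inv` ∕ `_one`; ★ #7c `absDetDelta_mul`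
import Summits.HodgeConjecture.HodgeConjecture.Theorems.K2LiuA7NormaliserAlgebra              -- ★ B7-prep `aNum_two`, `bDen_two_ne_zero`, `lF_two_mul_ne_zero`, `lEN_ne_zero`
import Literature.NumberTheory.GelbartRogawski1991.LocalDoubledUnitarySmooth                 -- ★ `continuous_detDeltaGL`, `detDelta_eq_detDeltaGL`
import Literature.NumberTheory.K2Lit.LocalSiegelIntertwining                                -- ★ D10 `localIntertwining`
import HarnessLib

/-!
# Crux `HLiu418`, road `K2_Liu`, organ A7-val, file V1: THE VALUE FUNCTIONAL OF THE NORMALISED SIEGEL INTERTWINING OPERATOR AT `½`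
# — uniqueness, linearity over Laurent-monomial combinations, and RIGHT-TRANSLATION EQUIVARIANCE along `K₀`-flat families

Cell `hodgecm-mathlib`, crux item hLiu418 = `stmt-HodgeConjecture-24832`; squad K2 ∕ K2Liu; prover K2Liu-p09 (g6).  THEOREMS ONLY (no `def`, no instance,
no notation, no named-fact hypothesis, no `sorry`); lane `--supports stmt-HodgeConjecture-24832` (count-neutral helper).  RANK-GENERIC (`n`), FRAME-FREE,
every finite place; the (A4′-R) face ★ B7 `K2LiuA7NormalisedRegularity` (n = 2) is consumed only in the ∀∃-SHAPE `hA4R` of §4 (a hypothesis binder of the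
form of its conclusion, discharged at `n = 2` by ★ `normalisedRegularity` ∕ `normalisedRegularity_cm`).
THE POINT (A7-val census `REPORT-FIRST-A7val-PaperFirst` (M1)).  (A4′-R) says: for a `K₀`-flat family `f` of smooth Siegel sections (`K₀ ≤ H_v` an Iwasawa compact)
there is `Fn`, rational in `q_v^{-s}` and regular at `½`, with `M_v(s)(f s) h = aNorm n χ_v vol s · Fn s h` on `1 < re s`.  This file makes `Fn(½, ·)` a FUNCTIONAL:
* §1 `value_eq_sum`: if `F s = Σ_j c_j(s) · f_j s` on `1 < re s` with `c_j` regular at `½`, each `f_j` integrable with value `Fn_j`, and `M_v(s)(F s) h = aNorm(s) · G s h` with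
  `G(·,h)` regular at `½`, then **`G(½) h = Σ_j c_j(½) · Fn_j(½) h`** (★ F1 `eq_of_eqOn_halfPlane`, `aNorm ≠ 0` on `1 < re s` as a binder); `value_unique` (`J = {⋆}`).
* §2 `absDetDelta_eq_one_of_mem` — `|det_Δ p|_v = 1` for `p ∈ P_Δ(F_v) ∩ K₀`, `K₀` COMPACT (the powers `p^{±j}` stay in `K₀`, `|det_Δ|_v` is continuous and multiplicative);
  hence the IWASAWA HEIGHT `x = p k ↦ |det_Δ p|_v` is well defined, left-`P_Δ`-multiplicative, right-`K₀`-invariant.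
* §3 `apply_eq_cpow_mul_apply` — a `K₀`-flat family is `f s x = |det_Δ p(x)|_v^{s − s₁} · f s₁ x` (★ B2 `apply_eq_localSiegelCharacter_mul_of_flat`).
* §4 **`value_translate`** — for `g ∈ H_v`, the `K₀`-flat family `f` through `φ` and the `K₀`-flat family `f^g` through `x ↦ φ(x g)`:
  **`Fn^g(½) h = Fn(½) (h g)`**.  MECHANISM: `x ↦ f s (x g)` is a FINITE SUM `Σ_m (q_v^m)^{s−½} · f_m s` of `K₀`-flat smooth Siegel families
  (`f_m := 𝟙[height ratio = q_v^m] · f^g`; finitely many `m` because the ratio is left-`P_Δ`-invariant and right-invariant under the open `K₀ ∩ g K₀ g⁻¹`,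
  `K₀` compact), `Σ_m f_m = f^g`, and §1 twice.  So `φ ↦ Fn(½)` is `H_v`-EQUIVARIANT — the input (M1) of the multiplicity-one road to (A4″-KR).
* §5 `aNorm_two_ne_zero` — the `haN` binder at `n = 2` (★ B7-prep).
HONEST LABEL.  `HC_CM` is proved only modulo the 7 printed citations (2 remaining named inputs: hLiu418 = `stmt-HodgeConjecture-24832`,
h413 = `stmt-HodgeConjecture-24833`) until rung 0 closes.

## References
* [KudlaSweet1997] S. Kudla, W. J. Sweet, Israel J. Math. 98 (1997), §1 (standard sections; `M*(s)` on `K`-finite families; rationality in `q^{-s}`).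
* [Casselman1980] W. Casselman, Compositio Math. 40 (1980), §3 (the height `|det_Δ p(x)|`, Iwasawa decomposition, rational families).
* [HarrisKudlaSweet1996] M. Harris, S. Kudla, W. J. Sweet, J. AMS 9 (1996), §1 (1.15), §6 (6.14)–(6.16).
* [BernsteinZelevinsky1976] I. N. Bernstein, A. V. Zelevinsky, Russian Math. Surveys 31 (1976), §1.5 (locally constant functions on compact sets take finitely many values).
-/

set_option autoImplicit false
set_option linter.dupNamespace false -- the mandated namespace repeats `HodgeConjecture.HodgeConjecture`

noncomputable section

open scoped Classical NNReal ENNReal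
open NumberField IsDedekindDomain MeasureTheory Topology
open Literature.NumberTheory.GaloisRepresentations Literature.NumberTheory.GaloisRepresentations.IsNonarchimedeanLocalField
open Literature.NumberTheory.Automorphic Literature.NumberTheory.Automorphic.UnitaryGroup
open Literature.NumberTheory.GelbartRogawski1991.UnitaryDualPair.LocalSplitting
open Literature.NumberTheory.K2Lit.LocalSiegelDoubled
open Summit.HodgeConjecture.HodgeConjecture.Cruxes.HLiu418.K2LiuQRationalDefs
open Summit.HodgeConjecture.HodgeConjecture.Cruxes.HLiu418.K2LiuLocalLFactorDefs
open Summit.HodgeConjecture.HodgeConjecture.Cruxes.HLiu418.K2LiuLocalSiegel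
open Summit.HodgeConjecture.HodgeConjecture.Cruxes.HLiu418.K2LiuLocalIntertwiningProperty
open Summit.HodgeConjecture.HodgeConjecture.Cruxes.HLiu418.K2LiuFlatSiegelFamilies
open Summit.HodgeConjecture.HodgeConjecture.Cruxes.HLiu418.K2LiuQRationalLFactor
open Summit.HodgeConjecture.HodgeConjecture.Cruxes.HLiu418.K2LiuA7NormaliserAlgebra

namespace Summit.HodgeConjecture.HodgeConjecture.Cruxes.HLiu418.K2LiuA7ValueFunctional

variable (F : Type) [Field F] [NumberField F] (E : Type) [Field E] [NumberField E] [Algebra F E]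
  [Algebra.IsQuadraticExtension F E] (c : E ≃ₐ[F] E)
  {δ : E} (hcδ : c δ = -δ) (hδ : δ ≠ 0) {d : F} (hd : δ * δ = algebraMap F E d) (v : HeightOneSpectrum (𝓞 F)) (n : ℕ)
  {T₀ : Matrix (Fin n) (Fin n) F} (hT₀ : T₀.IsSymm) {JD : Matrix (Fin (n + n)) (Fin (n + n)) E} (hJD : JD = (gramD F n T₀).map (algebraMap F E))

/-! ## §1 The value at `½` of a Laurent-monomial combination -/

section Value

variable [MeasurableSpace (unipDeltaLocal F E c v n (JD := JD))] (νN : Measure (unipDeltaLocal F E c v n (JD := JD)))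
  (χv : ∀ w : PlacesOver E v, (w.1.adicCompletion E)ˣ →* ℂˣ) (vol : ℝ)
  (haN : ∀ s : ℂ, 1 < s.re → aNorm F E c v n χv vol s ≠ 0)

omit [Algebra.IsQuadraticExtension F E] in
/-- `2 ≤ q_v` (the residue field has at least two elements). [folklore] -/
theorem two_le_residueFieldCard : 2 ≤ residueFieldCard (v.adicCompletion F) := one_lt_residueFieldCard (v.adicCompletion F)

omit [Algebra.IsQuadraticExtension F E] in
include hJD haN in
/-- **THE VALUE OF A LAURENT-MONOMIAL COMBINATION.**  If on `1 < re s` the section `F s` is `Σ_{j ∈ J} c_j(s) · f_j s` pointwise, each `u ↦ f_j s (w_Δ u h)`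
is `νN`-integrable with `M_v(s)(f_j s) h = aNorm(s) · Fn_j s h`, `M_v(s)(F s) h = aNorm(s) · G s h`, and `c_j`, `Fn_j(·) h`, `G(·) h` are `q_v^{-s}`-rational and
regular at `½` (`aNorm ≠ 0` on `1 < re s`), then `G(½) h = Σ_j c_j(½) · Fn_j(½) h` — linearity of the integral on the half-plane plus the identity principle
★ F1 `eq_of_eqOn_halfPlane`. [cite: KudlaSweet1997, §1] [cite: Casselman1980, §3] -/
theorem value_eq_sum {ι : Type*} (J : Finset ι) (cj : ι → ℂ → ℂ)
    (hcj : ∀ j ∈ J, IsQRationalRegularAt (residueFieldCard (v.adicCompletion F)) (1 / 2) (cj j))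
    (fj : ι → ℂ → UnitaryGroup.localPi E c (n + n) JD v → ℂ) (Fnj : ι → ℂ → UnitaryGroup.localPi E c (n + n) JD v → ℂ) (h : UnitaryGroup.localPi E c (n + n) JD v)
    (hFnj_reg : ∀ j ∈ J, IsQRationalRegularAt (residueFieldCard (v.adicCompletion F)) (1 / 2) fun s => Fnj j s h)
    (hFnj : ∀ j ∈ J, ∀ s : ℂ, 1 < s.re → localIntertwining F E c v n hJD νN (fj j s) h = aNorm F E c v n χv vol s * Fnj j s h)
    (hint : ∀ j ∈ J, ∀ s : ℂ, 1 < s.re →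
      Integrable (fun u : unipDeltaLocal F E c v n (JD := JD) => fj j s (weylDelta F E c v n hJD * (u : UnitaryGroup.localPi E c (n + n) JD v) * h)) νN)
    (Fsum : ℂ → UnitaryGroup.localPi E c (n + n) JD v → ℂ) (hF : ∀ s : ℂ, 1 < s.re → ∀ x, Fsum s x = ∑ j ∈ J, cj j s * fj j s x)
    (G : ℂ → ℂ) (hG_reg : IsQRationalRegularAt (residueFieldCard (v.adicCompletion F)) (1 / 2) G)
    (hGF : ∀ s : ℂ, 1 < s.re → localIntertwining F E c v n hJD νN (Fsum s) h = aNorm F E c v n χv vol s * G s) :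
    G (1 / 2) = ∑ j ∈ J, cj j (1 / 2) * Fnj j (1 / 2) h := by
  refine IsQRationalRegularAt.eq_of_eqOn_halfPlane (two_le_residueFieldCard F v) hG_reg
    (IsQRationalRegularAt.sum J fun j hj => (hcj j hj).mul (hFnj_reg j hj)) 1 fun s hs => ?_
  have hM : localIntertwining F E c v n hJD νN (Fsum s) h = ∑ j ∈ J, cj j s * localIntertwining F E c v n hJD νN (fj j s) h := by
    unfold localIntertwining
    rw [integral_congr_ae (Filter.Eventually.of_forall fun u => hF s hs _), integral_finsetSum J fun j hj => (hint j hj s hs).const_mul (cj j s)]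
    exact Finset.sum_congr rfl fun j _ => integral_const_mul _ _
  have hsum : aNorm F E c v n χv vol s * G s = aNorm F E c v n χv vol s * ∑ j ∈ J, cj j s * Fnj j s h := by
    rw [← hGF s hs, hM, Finset.mul_sum]
    exact Finset.sum_congr rfl fun j hj => by rw [hFnj j hj s hs]; ring
  exact mul_left_cancel₀ (haN s hs) hsum

omit [Algebra.IsQuadraticExtension F E] in
include hJD haN in
/-- **UNIQUENESS OF THE VALUE**: two value data `Fn`, `Fn′` of the same family (integrable on `1 < re s`) agree at `½`. [cite: KudlaSweet1997, §1] -/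
theorem value_unique (f : ℂ → UnitaryGroup.localPi E c (n + n) JD v → ℂ) (Fn Fn' : ℂ → UnitaryGroup.localPi E c (n + n) JD v → ℂ)
    (h : UnitaryGroup.localPi E c (n + n) JD v)
    (hFn_reg : IsQRationalRegularAt (residueFieldCard (v.adicCompletion F)) (1 / 2) fun s => Fn s h)
    (hFn'_reg : IsQRationalRegularAt (residueFieldCard (v.adicCompletion F)) (1 / 2) fun s => Fn' s h)
    (hFn : ∀ s : ℂ, 1 < s.re → localIntertwining F E c v n hJD νN (f s) h = aNorm F E c v n χv vol s * Fn s h)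
    (hFn' : ∀ s : ℂ, 1 < s.re → localIntertwining F E c v n hJD νN (f s) h = aNorm F E c v n χv vol s * Fn' s h) :
    Fn (1 / 2) h = Fn' (1 / 2) h :=
  IsQRationalRegularAt.eq_of_eqOn_halfPlane (two_le_residueFieldCard F v) hFn_reg hFn'_reg 1 fun s hs =>
    mul_left_cancel₀ (haN s hs) ((hFn s hs).symm.trans (hFn' s hs))

end Value

/-! ## §2 The height `|det_Δ p|_v` is `1` on `P_Δ(F_v) ∩ K₀` for `K₀` compact; the Iwasawa height is well defined -/

section Height

omit [Algebra.IsQuadraticExtension F E] in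
/-- `h ↦ |det_Δ h|_v` is continuous on `H_v` (★ `continuous_detDeltaGL` componentwise). [cite: Casselman1980, §3] -/
theorem continuous_absDetDelta : Continuous (absDetDelta F E c v n (JD := JD)) := by
  unfold absDetDelta
  refine continuous_finsetProd _ fun w _ => Continuous.norm ?_
  show Continuous fun h : UnitaryGroup.localPi E c (n + n) JD v => detDeltaGL F E v n w ((h : UnitaryGroup.LocalGLPi E (n + n) v) w)
  exact (continuous_detDeltaGL F E v n w).comp ((continuous_apply w).comp continuous_subtype_val)

include hcδ hδ hd hT₀ hJD in
/-- `|det_Δ (p^j)|_v = |det_Δ p|_v^j` on `P_Δ(F_v)`. [cite: HarrisKudlaSweet1996, §1 (1.15)] -/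
theorem absDetDelta_pow {p : UnitaryGroup.localPi E c (n + n) JD v} (hp : IsSiegelDelta F E c hcδ hδ hd v n hT₀ hJD p) (j : ℕ) :
    absDetDelta F E c v n (p ^ j) = absDetDelta F E c v n p ^ j := by
  induction j with
  | zero => rw [pow_zero, pow_zero, absDetDelta_one]
  | succ j ih => rw [pow_succ, absDetDelta_mul F E c hcδ hδ hd v n hT₀ hJD _ _ hp, ih, pow_succ]

include hcδ hδ hd hT₀ hJD in
/-- **`|det_Δ p|_v = 1` for `p ∈ P_Δ(F_v) ∩ K₀`, `K₀` a COMPACT subgroup**: `|det_Δ|_v` is bounded on `K₀` and `|det_Δ p^{±j}|_v = |det_Δ p|_v^{±j}`.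
[cite: Casselman1980, §3] [cite: HarrisKudlaSweet1996, §1 (1.15)] -/
theorem absDetDelta_eq_one_of_mem (K₀ : Subgroup (UnitaryGroup.localPi E c (n + n) JD v)) (hK₀ : IsCompact (K₀ : Set (UnitaryGroup.localPi E c (n + n) JD v)))
    {p : UnitaryGroup.localPi E c (n + n) JD v} (hp : IsSiegelDelta F E c hcδ hδ hd v n hT₀ hJD p) (hpK : p ∈ K₀) :
    absDetDelta F E c v n p = 1 := by
  obtain ⟨C, hC⟩ := hK₀.bddAbove_image (continuous_absDetDelta F E c v n (JD := JD)).continuousOn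
  have hbound : ∀ x ∈ K₀, absDetDelta F E c v n x ≤ C := fun x hx => hC ⟨x, hx, rfl⟩
  have hpos := absDetDelta_pos F E c hcδ hδ hd v n hT₀ hJD hp
  -- neither `a > 1` nor `a < 1` is compatible with boundedness of `a^j` and `a^{-j}`
  rcases lt_trichotomy (absDetDelta F E c v n p) 1 with hlt | heq | hgt
  · exfalso
    have hinv : 1 < (absDetDelta F E c v n p)⁻¹ := (one_lt_inv₀ hpos).2 hlt
    obtain ⟨j, hj⟩ := pow_unbounded_of_one_lt C hinv
    have hle := hbound (p⁻¹ ^ j) (K₀.pow_mem (K₀.inv_mem hpK) j)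
    rw [absDetDelta_pow F E c hcδ hδ hd v n hT₀ hJD hp.inv, absDetDelta_inv F E c hcδ hδ hd v n hT₀ hJD hp] at hle
    exact not_lt.2 hle hj
  · exact heq
  · exfalso
    obtain ⟨j, hj⟩ := pow_unbounded_of_one_lt C hgt
    have hle := hbound (p ^ j) (K₀.pow_mem hpK j)
    rw [absDetDelta_pow F E c hcδ hδ hd v n hT₀ hJD hp] at hle
    exact not_lt.2 hle hj

include hcδ hδ hd hT₀ hJD in
/-- **the Iwasawa height is well defined**: `p k = p′ k′` with `p, p′ ∈ P_Δ(F_v)`, `k, k′ ∈ K₀` (compact) ⇒ `|det_Δ p|_v = |det_Δ p′|_v`. [cite: Casselman1980, §3] -/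
theorem absDetDelta_eq_of_mul_eq_mul (K₀ : Subgroup (UnitaryGroup.localPi E c (n + n) JD v)) (hK₀ : IsCompact (K₀ : Set (UnitaryGroup.localPi E c (n + n) JD v)))
    {p p' k k' : UnitaryGroup.localPi E c (n + n) JD v} (hp : IsSiegelDelta F E c hcδ hδ hd v n hT₀ hJD p) (hp' : IsSiegelDelta F E c hcδ hδ hd v n hT₀ hJD p')
    (hk : k ∈ K₀) (hk' : k' ∈ K₀) (h : p * k = p' * k') : absDetDelta F E c v n p = absDetDelta F E c v n p' := by
  -- `p′⁻¹ p = k′ k⁻¹ ∈ P_Δ ∩ K₀`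
  have hq : p'⁻¹ * p = k' * k⁻¹ := by
    rw [inv_mul_eq_iff_eq_mul, ← mul_inv_eq_iff_eq_mul.2 h.symm, mul_assoc]
  have hone := absDetDelta_eq_one_of_mem F E c hcδ hδ hd v n hT₀ hJD K₀ hK₀ (hp'.inv.mul hp) (by rw [hq]; exact K₀.mul_mem hk' (K₀.inv_mem hk))
  have hmul : absDetDelta F E c v n p = absDetDelta F E c v n p' * absDetDelta F E c v n (p'⁻¹ * p) := by
    rw [← absDetDelta_mul F E c hcδ hδ hd v n hT₀ hJD _ _ (hp'.inv.mul hp), mul_inv_cancel_left]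
  rw [hmul, hone, mul_one]

end Height

/-! ## §3 A `K₀`-flat family is `|det_Δ p(x)|_v^{s − s₁}` times its member at `s₁` -/

section Flat

variable (χv : ∀ w : PlacesOver E v, (w.1.adicCompletion E)ˣ →* ℂˣ)

include hcδ hδ hd hT₀ hJD in
/-- `χ_s(p) = |det_Δ p|_v^{s − s₁} · χ_{s₁}(p)` on `P_Δ(F_v)` (`|det_Δ p|_v > 0`). [cite: HarrisKudlaSweet1996, §1 (1.15)] -/
theorem localSiegelCharacter_eq_cpow_mul {p : UnitaryGroup.localPi E c (n + n) JD v} (hp : IsSiegelDelta F E c hcδ hδ hd v n hT₀ hJD p) (s s₁ : ℂ) :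
    localSiegelCharacter F E c v n χv s p = ((absDetDelta F E c v n p : ℝ) : ℂ) ^ (s - s₁) * localSiegelCharacter F E c v n χv s₁ p := by
  have h0 : ((absDetDelta F E c v n p : ℝ) : ℂ) ≠ 0 := Complex.ofReal_ne_zero.2 (absDetDelta_pos F E c hcδ hδ hd v n hT₀ hJD hp).ne'
  simp only [localSiegelCharacter]
  rw [show s + (n : ℂ) / 2 = (s - s₁) + (s₁ + (n : ℂ) / 2) by ring, Complex.cpow_add _ _ h0]
  ring

variable {f : ℂ → UnitaryGroup.localPi E c (n + n) JD v → ℂ} (hSieg : ∀ s, IsLocalSiegelSection F E c hcδ hδ hd v n hT₀ hJD χv s (f s))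
  {K₀ : Subgroup (UnitaryGroup.localPi E c (n + n) JD v)} (hflat : ∀ s s' : ℂ, ∀ k ∈ K₀, f s k = f s' k)

include hSieg hflat in
/-- **a flat family is a height power times one member**: `f s (p k) = |det_Δ p|_v^{s − s₁} · f s₁ (p k)` for `p ∈ P_Δ(F_v)`, `k ∈ K₀`.
[cite: KudlaSweet1997, §1] [cite: Casselman1980, §3] -/
theorem apply_eq_cpow_mul_apply {p : UnitaryGroup.localPi E c (n + n) JD v} (hp : IsSiegelDelta F E c hcδ hδ hd v n hT₀ hJD p)
    {k : UnitaryGroup.localPi E c (n + n) JD v} (hk : k ∈ K₀) (s s₁ : ℂ) :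
    f s (p * k) = ((absDetDelta F E c v n p : ℝ) : ℂ) ^ (s - s₁) * f s₁ (p * k) := by
  rw [apply_eq_localSiegelCharacter_mul_of_flat F E c hcδ hδ hd v n hT₀ hJD χv hSieg hflat hp hk s s₁,
    apply_eq_localSiegelCharacter_mul_of_flat F E c hcδ hδ hd v n hT₀ hJD χv hSieg hflat hp hk s₁ s₁,
    localSiegelCharacter_eq_cpow_mul F E c hcδ hδ hd v n hT₀ hJD χv hp s s₁, mul_assoc]

end Flat

/-! ## §4 Right-translation equivariance of the value functional -/

section Translate

variable [MeasurableSpace (unipDeltaLocal F E c v n (JD := JD))] (νN : Measure (unipDeltaLocal F E c v n (JD := JD)))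
  (χv : ∀ w : PlacesOver E v, (w.1.adicCompletion E)ˣ →* ℂˣ) (vol : ℝ)
  (haN : ∀ s : ℂ, 1 < s.re → aNorm F E c v n χv vol s ≠ 0)
  (K₀ : Subgroup (UnitaryGroup.localPi E c (n + n) JD v))
  (hK₀ : IsCompact (K₀ : Set (UnitaryGroup.localPi E c (n + n) JD v)) ∧ IsOpen (K₀ : Set (UnitaryGroup.localPi E c (n + n) JD v)))
  (hIw : ∀ x : UnitaryGroup.localPi E c (n + n) JD v, ∃ p, IsSiegelDelta F E c hcδ hδ hd v n hT₀ hJD p ∧ ∃ k ∈ K₀, x = p * k)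
  -- the (A4′-R) face in ∀∃-shape (★ B7 `normalisedRegularity` at `n = 2`) and the integrability it comes with (★ B7-M2 ∕ B4d-3 at `n = 2`)
  (hA4R : ∀ f' : ℂ → UnitaryGroup.localPi E c (n + n) JD v → ℂ, (∀ s, IsLocalSiegelSection F E c hcδ hδ hd v n hT₀ hJD χv s (f' s)) →
    (∀ s, IsSmooth F E c v n (f' s)) → (∀ s s' : ℂ, ∀ k ∈ K₀, f' s k = f' s' k) →
    ∃ Fn' : ℂ → UnitaryGroup.localPi E c (n + n) JD v → ℂ, (∀ h, IsQRationalRegularAt (residueFieldCard (v.adicCompletion F)) (1 / 2) fun s => Fn' s h) ∧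
      ∀ s : ℂ, 1 < s.re → ∀ h, localIntertwining F E c v n hJD νN (f' s) h = aNorm F E c v n χv vol s * Fn' s h)
  (hintA : ∀ f' : ℂ → UnitaryGroup.localPi E c (n + n) JD v → ℂ, (∀ s, IsLocalSiegelSection F E c hcδ hδ hd v n hT₀ hJD χv s (f' s)) →
    (∀ s, IsSmooth F E c v n (f' s)) → (∀ s s' : ℂ, ∀ k ∈ K₀, f' s k = f' s' k) → ∀ s : ℂ, 1 < s.re → ∀ h,
      Integrable (fun u : unipDeltaLocal F E c v n (JD := JD) => f' s (weylDelta F E c v n hJD * (u : UnitaryGroup.localPi E c (n + n) JD v) * h)) νN)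
  {f : ℂ → UnitaryGroup.localPi E c (n + n) JD v → ℂ} (hSieg : ∀ s, IsLocalSiegelSection F E c hcδ hδ hd v n hT₀ hJD χv s (f s))
  (hflat : ∀ s s' : ℂ, ∀ k ∈ K₀, f s k = f s' k)
  (g : UnitaryGroup.localPi E c (n + n) JD v)
  {fg : ℂ → UnitaryGroup.localPi E c (n + n) JD v → ℂ} (hSiegg : ∀ s, IsLocalSiegelSection F E c hcδ hδ hd v n hT₀ hJD χv s (fg s))
  (hsmg : ∀ s, IsSmooth F E c v n (fg s)) (hflatg : ∀ s s' : ℂ, ∀ k ∈ K₀, fg s k = fg s' k) (hthrough : ∀ x, fg (1 / 2) x = f (1 / 2) (x * g))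
  {Fn : ℂ → UnitaryGroup.localPi E c (n + n) JD v → ℂ} (hFn_reg : ∀ h, IsQRationalRegularAt (residueFieldCard (v.adicCompletion F)) (1 / 2) fun s => Fn s h)
  (hFn : ∀ s : ℂ, 1 < s.re → ∀ h, localIntertwining F E c v n hJD νN (f s) h = aNorm F E c v n χv vol s * Fn s h)
  {Fng : ℂ → UnitaryGroup.localPi E c (n + n) JD v → ℂ} (hFng_reg : ∀ h, IsQRationalRegularAt (residueFieldCard (v.adicCompletion F)) (1 / 2) fun s => Fng s h)
  (hFng : ∀ s : ℂ, 1 < s.re → ∀ h, localIntertwining F E c v n hJD νN (fg s) h = aNorm F E c v n χv vol s * Fng s h)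

include hK₀ hIw hA4R hintA hSieg hflat hSiegg hsmg hflatg hthrough hFn_reg hFn hFng_reg hFng haN in
/-- **RIGHT-TRANSLATION EQUIVARIANCE OF THE VALUE AT `½`.**  Let `K₀ ≤ H_v` be an Iwasawa compact, `f` the `K₀`-flat family of Siegel sections through `φ := f(½)`,
`f^g` the `K₀`-flat family of smooth Siegel sections through `x ↦ φ(x g)`, with (A4′-R) values `Fn`, `Fn^g`.  Then **`Fn^g(½) h = Fn(½) (h g)`**.
MECHANISM: with the Iwasawa height `ν(x) = |det_Δ p(x)|_v` (§2) one has `f s (x g) = (ν(xg)∕ν(x))^{s−½} · f^g s x` (§3); the ratio `ν(xg)∕ν(x) = q_v^{e(x)}` is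
left-`P_Δ`-invariant and right-`K₀ ∩ gK₀g⁻¹`-invariant, so `e` takes finitely many values on the compact `K₀` (hence on `H_v = P_Δ K₀`); the pieces
`f_m := 𝟙[e = m] · f^g` are `K₀`-flat smooth Siegel families with `Σ_m f_m = f^g` and `x ↦ f s (x g) = Σ_m (q_v^m)^{s−½} f_m s x`; (A4′-R) values the pieces and
§1 (twice, `M_v(s)(x ↦ f s (x g))(h) = M_v(s)(f s)(h g)`) gives both sides as `Σ_m Fn_m(½) h`. [cite: KudlaSweet1997, §1] [cite: Casselman1980, §3]
[cite: BernsteinZelevinsky1976, §1.5] -/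
theorem value_translate (h : UnitaryGroup.localPi E c (n + n) JD v) : Fng (1 / 2) h = Fn (1 / 2) (h * g) := by
  -- Iwasawa choices and the height exponents
  choose pI hpI kI hkI hxI using hIw
  have hq0 : (0 : ℝ) < residueFieldCard (v.adicCompletion F) := by exact_mod_cast lt_trans zero_lt_one (one_lt_residueFieldCard (v.adicCompletion F))
  have hq1 : (residueFieldCard (v.adicCompletion F) : ℝ) ≠ 1 := by exact_mod_cast (one_lt_residueFieldCard (v.adicCompletion F)).ne'
  have hqn : residueFieldCard (v.adicCompletion F) ≠ 0 := residueFieldCard_ne_zero _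
  choose KI hKI using fun x => exists_absDetDelta_eq_zpow F E c hcδ hδ hd v n hT₀ hJD (hpI x)
  -- the height is well defined: left-multiplicative under `P_Δ`, right-invariant under `K₀`
  have hν_left : ∀ (p x : UnitaryGroup.localPi E c (n + n) JD v), IsSiegelDelta F E c hcδ hδ hd v n hT₀ hJD p →
      absDetDelta F E c v n (pI (p * x)) = absDetDelta F E c v n p * absDetDelta F E c v n (pI x) := fun p x hp => by
    rw [← absDetDelta_mul F E c hcδ hδ hd v n hT₀ hJD p (pI x) (hpI x)]
    exact absDetDelta_eq_of_mul_eq_mul F E c hcδ hδ hd v n hT₀ hJD K₀ hK₀.1 (hpI _) (hp.mul (hpI x)) (hkI _) (hkI x)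
      (by rw [← hxI (p * x), mul_assoc, ← hxI x])
  have hν_right : ∀ (x k : UnitaryGroup.localPi E c (n + n) JD v), k ∈ K₀ →
      absDetDelta F E c v n (pI (x * k)) = absDetDelta F E c v n (pI x) := fun x k hk =>
    absDetDelta_eq_of_mul_eq_mul F E c hcδ hδ hd v n hT₀ hJD K₀ hK₀.1 (hpI _) (hpI x) (hkI _) (K₀.mul_mem (hkI x) hk)
      (by rw [← hxI (x * k), ← mul_assoc, ← hxI x])
  -- the ratio exponent `e x := KI (x g) − KI x` and its invariances
  have hratio : ∀ x, (residueFieldCard (v.adicCompletion F) : ℝ) ^ (KI (x * g) - KI x) = absDetDelta F E c v n (pI (x * g)) / absDetDelta F E c v n (pI x) :=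
    fun x => by rw [zpow_sub₀ hq0.ne', hKI, hKI]
  have he_left : ∀ (p x : UnitaryGroup.localPi E c (n + n) JD v), IsSiegelDelta F E c hcδ hδ hd v n hT₀ hJD p →
      KI (p * x * g) - KI (p * x) = KI (x * g) - KI x := fun p x hp => by
    refine zpow_right_injective₀ hq0 hq1 ?_
    simp only [hratio]
    rw [mul_assoc, hν_left p (x * g) hp, hν_left p x hp, mul_div_mul_left _ _ (absDetDelta_pos F E c hcδ hδ hd v n hT₀ hJD hp).ne']
  have he_right : ∀ (x u : UnitaryGroup.localPi E c (n + n) JD v), u ∈ K₀ → g⁻¹ * u * g ∈ K₀ →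
      KI (x * u * g) - KI (x * u) = KI (x * g) - KI x := fun x u hu hug => by
    refine zpow_right_injective₀ hq0 hq1 ?_
    simp only [hratio]
    rw [show x * u * g = x * g * (g⁻¹ * u * g) by group, hν_right _ _ hug, hν_right _ _ hu]
  have he_kI : ∀ x, KI (x * g) - KI x = KI (kI x * g) - KI (kI x) := fun x => by
    conv_lhs => rw [hxI x]
    exact he_left (pI x) (kI x) (hpI x)
  -- finitely many values: `e` is locally constant on the compact `K₀`
  haveI : CompactSpace K₀ := isCompact_iff_compactSpace.1 hK₀.1
  have hVopen : IsOpen {u : UnitaryGroup.localPi E c (n + n) JD v | u ∈ K₀ ∧ g⁻¹ * u * g ∈ K₀} :=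
    hK₀.2.inter (hK₀.2.preimage ((continuous_const.mul continuous_id).mul continuous_const))
  have hlc : IsLocallyConstant fun k : K₀ => KI ((k : UnitaryGroup.localPi E c (n + n) JD v) * g) - KI (k : UnitaryGroup.localPi E c (n + n) JD v) := by
    refine (IsLocallyConstant.iff_exists_open _).2 fun k => ⟨{k' : K₀ | (k : UnitaryGroup.localPi E c (n + n) JD v)⁻¹ * k' ∈
      {u : UnitaryGroup.localPi E c (n + n) JD v | u ∈ K₀ ∧ g⁻¹ * u * g ∈ K₀}}, hVopen.preimage (continuous_const.mul continuous_subtype_val),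
      (show ((k : UnitaryGroup.localPi E c (n + n) JD v)⁻¹ * (k : UnitaryGroup.localPi E c (n + n) JD v) ∈ K₀) ∧
          (g⁻¹ * ((k : UnitaryGroup.localPi E c (n + n) JD v)⁻¹ * (k : UnitaryGroup.localPi E c (n + n) JD v)) * g ∈ K₀) by
        rw [inv_mul_cancel, mul_one, inv_mul_cancel]; exact ⟨K₀.one_mem, K₀.one_mem⟩), fun k' hk' => ?_⟩
    have h1 := he_right (k : UnitaryGroup.localPi E c (n + n) JD v) _ hk'.1 hk'.2
    rwa [mul_inv_cancel_left] at h1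
  obtain ⟨Mset, hMset⟩ : ∃ Mset : Finset ℤ, ∀ x : UnitaryGroup.localPi E c (n + n) JD v, KI (x * g) - KI x ∈ Mset :=
    ⟨hlc.range_finite.toFinset, fun x => by rw [Set.Finite.mem_toFinset, he_kI x]; exact ⟨⟨kI x, hkI x⟩, rfl⟩⟩
  -- the value formula for the two flat families
  have hfval : ∀ s y, f s y = ((absDetDelta F E c v n (pI y) : ℝ) : ℂ) ^ (s - 1 / 2) * f (1 / 2) y := fun s y => by
    conv_lhs => rw [hxI y]
    rw [apply_eq_cpow_mul_apply F E c hcδ hδ hd v n hT₀ hJD χv hSieg hflat (hpI y) (hkI y) s (1 / 2), ← hxI y]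
  have hgval : ∀ s y, fg s y = ((absDetDelta F E c v n (pI y) : ℝ) : ℂ) ^ (s - 1 / 2) * f (1 / 2) (y * g) := fun s y => by
    conv_lhs => rw [hxI y]
    rw [apply_eq_cpow_mul_apply F E c hcδ hδ hd v n hT₀ hJD χv hSiegg hflatg (hpI y) (hkI y) s (1 / 2), ← hxI y, hthrough]
  -- the pieces
  obtain ⟨piece, hpiece⟩ : ∃ piece : ℤ → ℂ → UnitaryGroup.localPi E c (n + n) JD v → ℂ, piece = fun m s x => if KI (x * g) - KI x = m then fg s x else 0 := ⟨_, rfl⟩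
  have hpS : ∀ m s, IsLocalSiegelSection F E c hcδ hδ hd v n hT₀ hJD χv s (piece m s) := fun m s p hp x => by
    simp only [hpiece, he_left p x hp, hSiegg s p hp x]
    split_ifs <;> simp
  have hpsm : ∀ m s, IsSmooth F E c v n (piece m s) := fun m s => by
    obtain ⟨U, hU⟩ := hsmg s
    have hVsub : ∃ W : Subgroup (UnitaryGroup.localPi E c (n + n) JD v), (W : Set (UnitaryGroup.localPi E c (n + n) JD v)) =
        {u | u ∈ K₀ ∧ g⁻¹ * u * g ∈ K₀} :=
      ⟨K₀ ⊓ K₀.comap (MulAut.conj g⁻¹).toMonoidHom, by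
        ext u; simp only [Subgroup.coe_inf, Subgroup.coe_comap, Set.mem_inter_iff, SetLike.mem_coe, Set.mem_preimage, MulEquiv.coe_toMonoidHom,
          MulAut.conj_apply, inv_inv, Set.mem_setOf_eq]⟩
    obtain ⟨W, hW⟩ := hVsub
    refine ⟨⟨W, by show IsOpen (W : Set (UnitaryGroup.localPi E c (n + n) JD v)); rw [hW]; exact hVopen⟩ ⊓ U, fun x u hu => ?_⟩
    have hu' : u ∈ (W : Set (UnitaryGroup.localPi E c (n + n) JD v)) ∧ u ∈ (U : Subgroup _) := by simpa [OpenSubgroup.coe_inf] using hu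
    rw [hW] at hu'
    simp only [hpiece, he_right x u hu'.1.1 hu'.1.2, hU x u hu'.2]
  have hpfl : ∀ m (s s' : ℂ), ∀ k ∈ K₀, piece m s k = piece m s' k := fun m s s' k hk => by simp only [hpiece, hflatg s s' k hk]
  -- their values and integrability
  choose Fnp hFnp_reg hFnp using fun m => hA4R (piece m) (hpS m) (hpsm m) (hpfl m)
  have hpint := fun m => hintA (piece m) (hpS m) (hpsm m) (hpfl m)
  -- the two sum identities
  have hsum_g : ∀ s x, fg s x = ∑ m ∈ Mset, (fun (_ : ℤ) (_ : ℂ) => (1 : ℂ)) m s * piece m s x := fun s x => by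
    simp only [hpiece, one_mul, Finset.sum_ite_eq, if_pos (hMset x)]
  have hsum_f : ∀ s : ℂ, 1 < s.re → ∀ x, f s (x * g) =
      ∑ m ∈ Mset, (fun (m : ℤ) (s : ℂ) => (((residueFieldCard (v.adicCompletion F) : ℝ) ^ m : ℝ) : ℂ) ^ (s - 1 / 2)) m s * piece m s x := fun s _ x => by
    simp only [hpiece, mul_ite, mul_zero, Finset.sum_ite_eq, if_pos (hMset x)]
    rw [hfval, hgval, ← mul_assoc, ← Complex.mul_cpow_ofReal_nonneg (zpow_nonneg hq0.le _) (absDetDelta_nonneg F E c v n _), ← Complex.ofReal_mul,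
      hratio, div_mul_cancel₀ _ (absDetDelta_pos F E c hcδ hδ hd v n hT₀ hJD (hpI x)).ne']
  -- §1 twice
  have hG : Fng (1 / 2) h = ∑ m ∈ Mset, (fun (_ : ℤ) (_ : ℂ) => (1 : ℂ)) m (1 / 2) * Fnp m (1 / 2) h :=
    value_eq_sum F E c v n hJD νN χv vol haN Mset _ (fun _ _ => isQRationalRegularAt_const _ _ _) piece Fnp h (fun m _ => hFnp_reg m h)
      (fun m _ s hs => hFnp m s hs h) (fun m _ s hs => hpint m s hs h) fg (fun s _ x => hsum_g s x) (fun s => Fng s h) (hFng_reg h) (fun s hs => hFng s hs h)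
  have hF : Fn (1 / 2) (h * g) = ∑ m ∈ Mset,
      (fun (m : ℤ) (s : ℂ) => (((residueFieldCard (v.adicCompletion F) : ℝ) ^ m : ℝ) : ℂ) ^ (s - 1 / 2)) m (1 / 2) * Fnp m (1 / 2) h := by
    refine value_eq_sum F E c v n hJD νN χv vol haN Mset _ (fun m _ => ?_) piece Fnp h (fun m _ => hFnp_reg m h)
      (fun m _ s hs => hFnp m s hs h) (fun m _ s hs => hpint m s hs h) (fun s x => f s (x * g)) hsum_f (fun s => Fn s (h * g)) (hFn_reg (h * g))
      (fun s hs => ?_)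
    · exact (isQRationalRegularAt_zpow_cpow_add hqn m (-(1 / 2)) (1 / 2)).congr fun s => by rw [sub_eq_add_neg]
    · rw [← hFn s hs (h * g)]
      unfold localIntertwining
      simp only [mul_assoc]
  rw [hG, hF]
  refine Finset.sum_congr rfl fun m _ => ?_
  simp only [sub_self, Complex.cpow_zero]

end Translate

/-! ## §5 `n = 2`: the binder `aNorm ≠ 0` on `1 < re s` for unitary `χ_v` -/

section Two

omit [Algebra.IsQuadraticExtension F E] in
/-- **`aNorm 2 χ_v vol s ≠ 0` for `1 < re s`**, `χ_v` unitary, `vol ≠ 0`: `a_2(s) = L_F(2s−1)·L_{E/F}(2s)/L_F(2s)` and `b_2(s)` are finite products of non-vanishing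
local factors there (★ B7-prep). Discharges the `haN` binder of §1∕§4 at `n = 2`. [cite: HarrisKudlaSweet1996, §6 (6.16)] [cite: KudlaSweet1997, §1] -/
theorem aNorm_two_ne_zero {χv : ∀ w : PlacesOver E v, (w.1.adicCompletion E)ˣ →* ℂˣ}
    (hχ : ∀ (w : PlacesOver E v) (x : (w.1.adicCompletion E)ˣ), ‖((χv w x : ℂˣ) : ℂ)‖ = 1) {vol : ℝ} (hvol : vol ≠ 0) {s : ℂ} (hs : 1 < s.re) :
    aNorm F E c v 2 χv vol s ≠ 0 := by
  rw [aNorm_def, aNum_two]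
  have h1 : 0 < (2 * s - 1).re := by simp [Complex.sub_re, Complex.mul_re]; linarith
  have h2 : 0 < (2 * s).re := by simp [Complex.mul_re]; linarith
  exact mul_ne_zero (Complex.ofReal_ne_zero.2 hvol) (div_ne_zero (mul_ne_zero (lF_ne_zero hχ h1)
    (div_ne_zero (lEN_ne_zero c χv hχ h2) (lF_two_mul_ne_zero χv hχ (by linarith)))) (bDen_two_ne_zero c χv hχ (by linarith)))

end Two

end Summit.HodgeConjecture.HodgeConjecture.Cruxes.HLiu418.K2LiuA7ValueFunctional

end
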